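import Summits.NavierStokesRegularity.NavierStokesRegularity.Theorems.ArgmaxDoorsGrowth
import Summits.NavierStokesRegularity.NavierStokesRegularity.Theorems.ArgmaxDoorsDefs
import Literature.Analysis.FluidPDE.ClassicalSolutionGlue
import HarnessLib

/-!
# ArgmaxDoorsEngine — door family S35 «ArgmaxDoors», plate E «ArgmaxEngine» PROVED BY NAME

Summits-side proof file (theorems only). Texts of record: nsreg-p1 g29 `r33/Sketch35.lean` v3 sha16
93168f45ce53c5c4 = tree P0 `Theorems/ArgmaxDoorsDefs.lean` (plate E was RE-TYPED by the planner to the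
LEAD's kernel shapes, STATUS 2026-08-28T15:22:50Z decision (2)(a)). Plate map 15:22:50Z (3): E = THE CONTENT
of doors A+B → LEAD ns-s30-p1 g3.

* `argmaxEngine_explicit` — `ArgmaxDoorsGrowth.norm_curl_le_mul_exp_of_argmax_rate_le` TIME-TRANSLATED to
  a slab `[t₁,t₂] ⊂ [0,T)` of the open frame (`u ↦ u(· + t₁)` on `[0, t₂ − t₁]`, `Φ ↦ Φ(· + t₁)`;
  `IsClassicalNSSolutionOn.translate_Ico_zero` + `mono`; the degenerate slab `t₁ = t₂` is trivial);
* `argmaxEngine_holds : ArgmaxEngine` — BY NAME against P0 (`IsVorticityArgmax` unfolds to the explicit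
  argmax clause).

HONEST FRAME / WHAT THIS IS NOT: the engine of three regularity CRITERIA about hypothetical blow-up; item
0056 `NoTypeII` and NS regularity are NOT proved; no Literature fact is taken as a hypothesis;
`--supports stmt-NavierStokesRegularity-0056 --as helper`.
-/

noncomputable section

set_option linter.dupNamespace false

open MeasureTheory Set Function Filter Metric Real InnerProductSpace
open _root_.Topology
open scoped ENNReal NNReal RealInnerProductSpace ContDiff Laplacian
open Literature.Analysis Literature.Analysis.FluidPDE
open Literature.Analysis.FluidPDE.VorticityDirectionDynamics

namespace Summit.NavierStokesRegularity.NavierStokesRegularity.Theorems.ArgmaxDoors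

-- nested operator types (second derivatives)
set_option maxSynthPendingDepth 3

/-- **Plate E «ArgmaxEngine» in explicit binder form** (the text of `ArgmaxDoorsDefs.ArgmaxEngine` with
`IsVorticityArgmax` unfolded): `norm_curl_le_mul_exp_of_argmax_rate_le` TIME-TRANSLATED to a slab
`[t₁,t₂] ⊂ [0,T)` of the open frame (`u ↦ u(· + t₁)` on `[0, t₂ − t₁]`, `Φ ↦ Φ(· + t₁)`). [folklore] -/
theorem argmaxEngine_explicit {ν T : ℝ} {u : ℝ → (EuclideanSpace ℝ (Fin 3)) → (EuclideanSpace ℝ (Fin 3))}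
    {p : ℝ → (EuclideanSpace ℝ (Fin 3)) → ℝ} (hν : 0 < ν)
    (hsol : IsClassicalNSSolutionOn (Ico 0 T) ν 0 u p)
    (hreg : ∀ T'' < T, HasBoundedSobolevNormsOn (Icc 0 T'') u)
    {Φ φ : ℝ → ℝ} {t₁ t₂ M : ℝ} (ht₁ : 0 ≤ t₁) (h₁₂ : t₁ ≤ t₂) (ht₂ : t₂ < T)
    (hΦc : ContinuousOn Φ (Icc t₁ t₂))
    (hΦ : ∀ t ∈ Icc t₁ t₂, HasDerivWithinAt Φ (φ t) (Icc t₁ t₂) t)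
    (hrate : ∀ t ∈ Ioc t₁ t₂, ∀ x, (∀ y, ‖curl (u t) y‖ ≤ ‖curl (u t) x‖) → curl (u t) x ≠ 0 →
      ⟪vorticityDirection (curl (u t)) x, fderiv ℝ (u t) x (vorticityDirection (curl (u t)) x)⟫ -
        ν * frobeniusNormSq (fderiv ℝ (vorticityDirection (curl (u t))) x) ≤ φ t)
    (hM : ∀ x, ‖curl (u t₁) x‖ ≤ M) :
    ∀ t ∈ Icc t₁ t₂, ∀ x, ‖curl (u t) x‖ ≤ M * Real.exp (Φ t - Φ t₁) := by
  rcases eq_or_lt_of_le h₁₂ with heq | hlt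
  · -- degenerate slab `t₁ = t₂`
    intro t ht x
    have htt : t = t₁ := le_antisymm (heq ▸ ht.2) ht.1
    rw [htt, sub_self, Real.exp_zero, mul_one]
    exact hM x
  -- the translated solution on `[0, t₂ − t₁]`
  set T'' : ℝ := t₂ - t₁ with hT''def
  have hT'' : 0 < T'' := by rw [hT''def]; linarith
  set v : ℝ → (EuclideanSpace ℝ (Fin 3)) → (EuclideanSpace ℝ (Fin 3)) := fun s => u (s + t₁) with hv
  set q : ℝ → (EuclideanSpace ℝ (Fin 3)) → ℝ := fun s => p (s + t₁) with hq
  have hS : IsClassicalNSSolutionOn (Icc 0 T'') ν 0 v q :=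
    (hsol.translate_Ico_zero ht₁).mono (fun s hs => ⟨hs.1, by rw [hT''def] at hs; linarith [hs.2]⟩)
      (uniqueDiffOn_Icc hT'')
  have hB : HasBoundedSobolevNormsOn (Icc 0 T'') v := by
    intro n
    obtain ⟨C', hC'⟩ := hreg t₂ ht₂ n
    exact ⟨C', fun s hs => hC' (s + t₁) ⟨by linarith [hs.1], by rw [hT''def] at hs; linarith [hs.2]⟩⟩
  -- the translated integrating factor
  set Ψ : ℝ → ℝ := fun s => Φ (s + t₁) with hΨ
  set ψ : ℝ → ℝ := fun s => φ (s + t₁) with hψ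
  have hmaps : MapsTo (fun s : ℝ => s + t₁) (Icc 0 T'') (Icc t₁ t₂) := fun s hs =>
    ⟨by linarith [hs.1], by rw [hT''def] at hs; linarith [hs.2]⟩
  have hΨc : ContinuousOn Ψ (Icc 0 T'') :=
    hΦc.comp (continuous_add_const t₁).continuousOn hmaps
  have hΨd : ∀ s ∈ Icc 0 T'', HasDerivWithinAt Ψ (ψ s) (Icc 0 T'') s := by
    intro s hs
    have hsh : HasDerivWithinAt (fun r : ℝ => r + t₁) 1 (Icc 0 T'') s :=
      (hasDerivWithinAt_id s _).add_const t₁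
    have h := (hΦ (s + t₁) (hmaps hs)).comp s hsh hmaps
    simpa [hΨ, hψ, Function.comp_def] using h
  have hrate' : ∀ s ∈ Icc 0 T'', 0 < s → ∀ x₀ : EuclideanSpace ℝ (Fin 3),
      (∀ x, ‖curl (v s) x‖ ≤ ‖curl (v s) x₀‖) → curl (v s) x₀ ≠ 0 →
      ⟪vorticityDirection (curl (v s)) x₀, fderiv ℝ (v s) x₀ (vorticityDirection (curl (v s)) x₀)⟫ -
          ν * frobeniusNormSq (fderiv ℝ (vorticityDirection (curl (v s))) x₀) ≤ ψ s := by
    intro s hs hspos x₀ hmax hne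
    exact hrate (s + t₁) ⟨by linarith, by rw [hT''def] at hs; linarith [hs.2]⟩ x₀ hmax hne
  have hM' : ∀ x, ‖curl (v 0) x‖ ≤ M := fun x => by
    simp only [hv, zero_add]; exact hM x
  have hmain := norm_curl_le_mul_exp_of_argmax_rate_le hν hT'' hS hB hΨc hΨd hrate' hM'
  intro t ht x
  have hs : t - t₁ ∈ Icc 0 T'' := ⟨by linarith [ht.1], by rw [hT''def]; linarith [ht.2]⟩
  have h := hmain (t - t₁) hs x
  simp only [hv, hΨ, sub_add_cancel, zero_add] at h
  exact h


/-- **Plate E «ArgmaxEngine» PROVED BY NAME** (text of `Theorems/ArgmaxDoorsDefs.lean`). [folklore] -/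
theorem argmaxEngine_holds : ArgmaxEngine := by
  intro ν T u p hν hsol hreg Φ φ t₁ t₂ M ht₁ h₁₂ ht₂ hΦc hΦ hrate hM
  exact argmaxEngine_explicit hν hsol hreg ht₁ h₁₂ ht₂ hΦc hΦ
    (fun t ht x hx hx0 => hrate t ht x hx hx0) hM

end Summit.NavierStokesRegularity.NavierStokesRegularity.Theorems.ArgmaxDoors

end
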